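import Summits.AnomalousDissipation.AnomalousDissipation.Theorems.BaireTransferDenseLoudDesignerForcesErgodicHyperbolicityCocycle
import Literature.Analysis.FluidPDE.PeriodicBoundedMildTorus
import Literature.Analysis.FluidPDE.EulerReynolds
import Literature.Analysis.FunctionSpaces.TorusLerayHelmholtz

/-!
# The hyperbolicity transfer to the derivative cocycle of the model map (registered tools stub A3
# `stub_hyperbolicityTransferTools` of block N-A, line `ergodic-budget-selection-closing`, crux
# `BaireTransfer.DenseLoudDesignerForces`, stmt-AnomalousDissipation-1143)

Summit-side ASSEMBLY (sorry-free, no definitions).  The classical one-zero-exponent hypothesis `IsHyperbolicMeasure`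
(linearised Navier–Stokes solutions along the trajectories of `μ`-almost every state, `…ErgodicLine.lean` §2) transfers to the
derivative cocycle `Tⁿ_y = D(g 1)(g_{n-1} y) ∘ ⋯ ∘ D(g 1)(y)` of the model map `g = F.modelMap ν xF U'` at `m`-almost every
point of the frame core (`Literature.Dynamics.Hyperbolic.IsHyperbolicSemiflowModel.hyperbolic`):

* `ae_comp_phase_of_ae` — a.e. bookkeeping: a `μ`-a.e. property holds at `φ_t (F.S y)` for `m`-a.e. `y` (measurable null hull,
  a.e.-measurability of `φ_t` from `(φ_t)_* μ = μ ≠ 0`, invariance, and `μ`-null sets pull back to `m`-null sets);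
* `stub_hyperbolicityTransferTools` (the REGISTERED stub, exact signature).  At such `y` with trajectory `u`
  (`exists_trajectory_of_mem_frameCore`): the cocycle is the frame of a classical linearised solution `W` along `u` on
  `[1, ∞)` (`exists_linearised_of_derivCocycle`), so `‖[W n]‖ ≤ ‖Tⁿ h‖` and `w₁ = W(1 + ·)` has sub-exponential growth along
  the shifted trajectory `u₁ = u(1 + ·)` of `φ_1 (F.S y)`; hyperbolicity there yields `a`; the corrected datum `h − a X(y)`
  has its own linearised solution `Wa` with `Wa 1 = W 1 − a ∂ₜu 1` (linearity of `T¹`, `T¹ X(y) = frame of ∂ₜu(1)` by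
  `fderiv_modelMap_one_flowDir`, injectivity of the frame on honest states), so `Wa(1 + ·)` decays exponentially in `L²`,
  hence in `H¹` one step later (A2 `stub_linearisedRateTransferTools`), and `‖Tⁿ⁺¹(h − a X)‖² ≤ 2 (‖Wa(n+1)‖₂² + ‖∇Wa(n+1)‖₂²)`
  (`ModelFrame.frame_norm_sq_le`) gives `SeqExpDecay`.

References: Z. Lian, L.-S. Young, JAMS 25 (2012) §1 (standing hypotheses: exactly one zero exponent); L. Barreira,
Ya. Pesin, *Introduction to Smooth Ergodic Theory* (2023) Ch. 2; P. Constantin, C. Foias, *Navier–Stokes Equations* (1988)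
Ch. 13–14.  Nothing is asserted; no definition is added.
-/

-- `Summit.<Summit>.<Problem>` is the tree's mandated summit-side namespace (CONVENTIONS §2); for this
-- single-conjunct summit the two coincide, so the duplicate is deliberate.
set_option linter.dupNamespace false

noncomputable section

open Set Function MeasureTheory Filter
open scoped ContDiff InnerProductSpace Topology

namespace Summit.AnomalousDissipation.AnomalousDissipation.Theorems.DenseLoudDesignerForces.Ergodic

open Literature.Analysis.FunctionSpaces Literature.Analysis.FunctionSpaces.Torus
open Literature.Analysis.FluidPDE Literature.Analysis.FluidPDE.Torus
open Summit.AnomalousDissipation.AnomalousDissipation.Theorems.DenseLoudDesignerForces.Negative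
open Literature.Dynamics.Hyperbolic

/-! ## A.e. bookkeeping -/

/-- **A `μ`-a.e. property holds at `φ_t (F.S y)` for `m`-a.e. `y`** when `μ` is `φ`-invariant and `μ`-null sets pull back under
`F.S` to `m`-null sets: the exceptional set has a measurable `μ`-null hull `N` (`exists_measurable_superset_of_null`), `φ_t` is
a.e.-measurable for `μ` (`(φ_t)_* μ = μ ≠ 0`), so `μ (φ_t ⁻¹' N) = μ N = 0` by invariance, and `F.S ⁻¹' (φ_t ⁻¹' N)` is `m`-null.
[folklore] -/
theorem ae_comp_phase_of_ae {K : Set Hsp} {φ : ℝ → Hsp → Hsp} {μ : Measure Hsp} (hμ : IsInvariantMeasure K φ μ) {P : Hsp → Prop}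
    (hP : ∀ᵐ x ∂μ, P x) (F : ModelFrame) {m : Measure Hsp} (hnull : ∀ s : Set Hsp, μ s = 0 → m (F.S ⁻¹' s) = 0) {t : ℝ}
    (ht : 0 ≤ t) : ∀ᵐ y ∂m, P (φ t (F.S y)) := by
  haveI : IsProbabilityMeasure μ := hμ.prob
  obtain ⟨N, hNsub, hNm, hNμ⟩ := exists_measurable_superset_of_null (ae_iff.1 hP)
  have hφ : AEMeasurable (φ t) μ := by
    refine AEMeasurable.of_map_ne_zero ?_
    rw [hμ.map_eq t ht]
    exact IsProbabilityMeasure.ne_zero μ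
  have h2 : μ (φ t ⁻¹' N) = 0 := by
    rw [← Measure.map_apply_of_aemeasurable hφ hNm, hμ.map_eq t ht]
    exact hNμ
  rw [ae_iff]
  exact measure_mono_null (fun y (hy : ¬P (φ t (F.S y))) => show φ t (F.S y) ∈ N from hNsub hy) (hnull _ h2)

/-! ## The registered tools stub -/

/-- **Tools stub A3 of block N-A (`stub_hyperbolicityTransferTools`) — THE HYPERBOLICITY TRANSFER.**  In the setting of the
smooth model of the NS phase `(K, φ)` with the hyperbolic invariant measure `μ` (frame `F`, forcing preimage `xF`, compact
invariant core `Kc`, tube `U ⊆ U'`, model map `g = F.modelMap ν xF U'` jointly continuous and smooth in the state on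
`[0, 3] × U`, conjugate to `φ` on the frame core, model measure `m` carried by the frame core and pulling back `μ`-null sets),
for `m`-a.e. `y` and every `h`: if `‖Tⁿ_y h‖` grows sub-exponentially then `‖Tⁿ_y (h − a X(y))‖` decays exponentially for some
`a`, where `Tⁿ_y` is the derivative cocycle of `g` and `X(y)` its flow direction.  See the module docstring for the proof.
[folklore] -/
theorem stub_hyperbolicityTransferTools {S : Finset (Fin 3 → ℤ)} {c : ↥S → (EuclideanSpace ℂ (Fin 3))} {ν : ℝ} {K : Set Hsp}
    {φ : ℝ → Hsp → Hsp} {μ : Measure Hsp} (hν : 0 < ν) (hK : IsNSPhase ν (force S c) K φ) (hμ : IsInvariantMeasure K φ μ)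
    (hH : IsHyperbolicMeasure ν (force S c) φ μ) (F : ModelFrame) (xF : Hsp) (hxF : F.S xF = stateOf (force S c))
    {Kc : Set Hsp} (hKcK : Kc ⊆ K) (hKc : IsCompact Kc) (hinv : ∀ t : ℝ, 0 ≤ t → φ t '' Kc = Kc)
    {U U' : Set Hsp} (hU : IsOpen U) (hU' : IsOpen U') (hbdd : Bornology.IsBounded U') (hUU' : U ⊆ U') (hΛU : F.S ⁻¹' Kc ⊆ U)
    (htube : ∀ y ∈ U, ∀ t ∈ Icc (0 : ℝ) 3, ∃ (ht : 0 ≤ t) (z : C(Icc (0 : ℝ) t, Hsp)),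
      F.IsMild ν xF ht y z ∧ (∀ r, z r ∈ U') ∧ F.modelMap ν xF U' t y = z ⟨t, ht, le_rfl⟩)
    (hcont : ContinuousOn (fun q : ℝ × Hsp => F.modelMap ν xF U' q.1 q.2) (Icc (0 : ℝ) 3 ×ˢ U))
    (hsmooth : ∀ t ∈ Icc (0 : ℝ) 3, ContDiffOn ℝ ∞ (fun y => F.modelMap ν xF U' t y) U)
    (hconj : ∀ t : ℝ, 0 ≤ t → ∀ y : Hsp, F.S y ∈ Kc → F.S (F.modelMap ν xF U' t y) = φ t (F.S y))
    {m : Measure Hsp} (hmΛ : m (F.S ⁻¹' Kc)ᶜ = 0) (hnull : ∀ s : Set Hsp, μ s = 0 → m (F.S ⁻¹' s) = 0) :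
    ∀ᵐ y ∂m, ∀ h : Hsp, SeqSubExpGrowth (fun n => ‖derivCocycle (F.modelMap ν xF U') y n h‖) →
      ∃ a : ℝ, SeqExpDecay (fun n => ‖derivCocycle (F.modelMap ν xF U') y n (h - a • flowDir (F.modelMap ν xF U') y)‖) := by
  -- the interface hypotheses not needed below
  have _ := hxF; have _ := hKc; have _ := hbdd; have _ := hsmooth
  -- (0) a.e. bookkeeping: core points at which hyperbolicity holds at `φ 1 (F.S y)`
  have hΛae : ∀ᵐ y ∂m, F.S y ∈ Kc := by
    have h := compl_mem_ae_iff.2 hmΛ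
    rw [compl_compl] at h
    exact h
  have hHae := ae_comp_phase_of_ae hμ hH F hnull zero_le_one
  filter_upwards [hΛae, hHae] with y hyΛ hHy h hsub
  -- (1) the objects at the core point `y`
  obtain ⟨u, p, hsol, hrep, hum, horb, hmaps, hsemi, hg0, ⟨σ₀, C₀, hσ₀, hGev⟩, B, hBM, hBC⟩ :=
    exists_trajectory_of_mem_frameCore hν hK F hKcK hinv hconj hyΛ
  have hx : F.S y ∈ K := hKcK hyΛ
  have hyU : ∀ t : ℝ, 0 ≤ t → F.modelMap ν xF U' t y ∈ U := fun t ht => hΛU (hmaps t ht)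
  have hy0 : y ∈ U := hΛU hyΛ
  have h3 : (0 : ℝ) < 3 := zero_lt_three
  have hsubI : Icc (0 : ℝ) 3 ⊆ Ici 0 := fun t ht => ht.1
  have hsol3 : IsClassicalNSSolutionOn (Icc 0 3) ν (fun _ => force S c) u p := hsol.mono hsubI (uniqueDiffOn_Icc h3)
  have hA1 := stub_timeDerivLinearisedTools h3 hsol3 fun t ht => hum t ht.1
  -- honest states and their frames
  have hfr : ∀ {v : (UnitAddTorus (Fin 3)) → (EuclideanSpace ℝ (Fin 3))}, IsSmooth v → IsDivFree v → HasZeroMean v →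
      F.S (F.S (stateOf v - stateOf (laplacian v))) = stateOf v := fun hv hd hmn =>
    stub_framePreimageTools F.ι F.b F.m F.hmodes F.S F.hS hv hd hmn
  have hfrnorm : ∀ {v : (UnitAddTorus (Fin 3)) → (EuclideanSpace ℝ (Fin 3))}, IsSmooth v → IsDivFree v → HasZeroMean v →
      ∫ x, ‖v x‖ ^ 2 ≤ ‖F.S (stateOf v - stateOf (laplacian v))‖ ^ 2 ∧
      ‖F.S (stateOf v - stateOf (laplacian v))‖ ^ 2 ≤ 2 * ((∫ x, ‖v x‖ ^ 2) + gradNormSq v) := by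
    intro v hv hd hmn
    obtain ⟨-, h1, h2⟩ := F.frame_norm_sq_le (F.S (stateOf v - stateOf (laplacian v)))
    rw [hfr hv hd hmn, norm_stateOf_sq hv hd hmn, eGradNormSq_congr_ae (rep_stateOf hv hd hmn),
      eGradNormSq_eq_ofReal_gradNormSq hv, ENNReal.toReal_ofReal (gradNormSq_nonneg _)] at h1 h2
    exact ⟨le_trans (le_add_of_nonneg_right (gradNormSq_nonneg _)) h1, h2⟩
  -- (2) the cocycle identification for the datum `h`
  obtain ⟨W, Q, hlinW, hTW⟩ := exists_linearised_of_derivCocycle F hν xF hU hU' hUU' htube hcont hyU hsol hum horb hsemi hg0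
    hσ₀ hGev h
  have hWh : ∀ t : ℝ, 1 ≤ t → IsSmooth (W t) ∧ IsDivFree (W t) ∧ HasZeroMean (W t) := fun t ht =>
    ⟨hlinW.1.isSmooth_slice (mem_Ici.2 ht), hlinW.2.2.1 t (mem_Ici.2 ht), hlinW.2.2.2.1 t (mem_Ici.2 ht)⟩
  -- (3) the shifted trajectory `u₁ = u (· + 1)` of `φ 1 (F.S y)` and the shifted linearised solutions
  have hsubpre : Ici (0 : ℝ) ⊆ (fun t : ℝ => t + 1) ⁻¹' Ici 0 := fun t ht =>
    mem_preimage.2 (mem_Ici.2 (by have := mem_Ici.1 ht; linarith))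
  have hsub1 : Ici (0 : ℝ) ⊆ (fun t : ℝ => t + 1) ⁻¹' Ici 1 := fun t ht =>
    mem_preimage.2 (mem_Ici.2 (by have := mem_Ici.1 ht; linarith))
  have hsol₁ : IsClassicalNSSolutionOn (Ici 0) ν (fun _ => force S c) (fun t => u (t + 1)) (fun t => p (t + 1)) :=
    (hsol.comp_add_const 1).mono hsubpre (uniqueDiffOn_Ici 0)
  have hrep₁ : ∀ t : ℝ, 0 ≤ t → rep (φ t (φ 1 (F.S y))) =ᵐ[volume] u (t + 1) := fun t ht => by
    rw [← hK.map_add t 1 ht zero_le_one _ hx]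
    exact hrep (t + 1) (by linarith)
  have hshift : ∀ {V : ℝ → (UnitAddTorus (Fin 3)) → (EuclideanSpace ℝ (Fin 3))} {P : ℝ → (UnitAddTorus (Fin 3)) → ℝ},
      IsLinearizedNSSolutionOn (Ici 1) ν u V P →
      IsLinearizedNSSolutionOn (Ici 0) ν (fun t => u (t + 1)) (fun t => V (t + 1)) fun t => P (t + 1) := by
    intro V P hl
    obtain ⟨hs1, hs2, hs3⟩ := linearisedNS_comp_add_const hl.1 hl.2.1 hl.2.2.2.2 1
    exact ⟨hs1.mono hsub1, hs2.mono hsub1, fun t ht => hl.2.2.1 (t + 1) (hsub1 ht), fun t ht => hl.2.2.2.1 (t + 1) (hsub1 ht),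
      fun t ht x => linearisedNS_mono hs1 hs3 hsub1 (uniqueDiffOn_Ici 0) ht x⟩
  -- (4) sub-exponential growth of `W (· + 1)` from the cocycle
  have hSub : SubExpGrowth fun t => W (t + 1) := by
    intro κ hκ
    obtain ⟨C, hC⟩ := hsub (κ / 2) (half_pos hκ)
    refine ⟨max C 0 ^ 2 * Real.exp κ, fun n => ?_⟩
    obtain ⟨hs, hd, hmn⟩ := hWh ((n : ℝ) + 1) (by have : (0 : ℝ) ≤ n := n.cast_nonneg; linarith)
    have hT := hTW (n + 1) (Nat.succ_pos n)
    rw [Nat.cast_succ] at hT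
    have hb : ‖derivCocycle (F.modelMap ν xF U') y (n + 1) h‖ ≤ max C 0 * Real.exp (κ / 2 * ((n : ℝ) + 1)) := by
      have h1 := hC (n + 1)
      rw [Nat.cast_succ] at h1
      exact h1.trans (mul_le_mul_of_nonneg_right (le_max_left _ _) (Real.exp_pos _).le)
    have hexp : (Real.exp (κ / 2 * ((n : ℝ) + 1))) ^ 2 = Real.exp κ * Real.exp (κ * n) := by
      rw [sq, ← Real.exp_add, ← Real.exp_add]
      congr 1
      ring
    calc ∫ x, ‖W ((n : ℝ) + 1) x‖ ^ 2 ≤ ‖F.S (stateOf (W ((n : ℝ) + 1)) - stateOf (laplacian (W ((n : ℝ) + 1))))‖ ^ 2 :=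
          (hfrnorm hs hd hmn).1
      _ = ‖derivCocycle (F.modelMap ν xF U') y (n + 1) h‖ ^ 2 := by rw [hT]
      _ ≤ (max C 0 * Real.exp (κ / 2 * ((n : ℝ) + 1))) ^ 2 := pow_le_pow_left₀ (norm_nonneg _) hb 2
      _ = max C 0 ^ 2 * Real.exp κ * Real.exp (κ * n) := by rw [mul_pow, hexp, mul_assoc]
  -- (5) hyperbolicity at `φ 1 (F.S y)`
  obtain ⟨a, ha⟩ := hHy (fun t => u (t + 1)) (fun t => p (t + 1)) hsol₁ hrep₁ (fun t => W (t + 1)) (fun t => Q (t + 1))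
    (hshift hlinW) hSub
  refine ⟨a, ?_⟩
  -- (6) the cocycle identification for the corrected datum `h - a • X`
  obtain ⟨Wa, Qa, hlinWa, hTWa⟩ := exists_linearised_of_derivCocycle F hν xF hU hU' hUU' htube hcont hyU hsol hum horb hsemi
    hg0 hσ₀ hGev (h - a • flowDir (F.modelMap ν xF U') y)
  have hWah : ∀ t : ℝ, 1 ≤ t → IsSmooth (Wa t) ∧ IsDivFree (Wa t) ∧ HasZeroMean (Wa t) := fun t ht =>
    ⟨hlinWa.1.isSmooth_slice (mem_Ici.2 ht), hlinWa.2.2.1 t (mem_Ici.2 ht), hlinWa.2.2.2.1 t (mem_Ici.2 ht)⟩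
  -- (7) the initial condition `Wa 1 = W 1 - a • ∂ₜu₁ 0`
  have h13 : (1 : ℝ) ∈ Icc (0 : ℝ) 3 := ⟨zero_le_one, by norm_num⟩
  have hdu : IsSmooth (Torus.timeDerivWithin (Icc 0 3) u 1) ∧ IsDivFree (Torus.timeDerivWithin (Icc 0 3) u 1) ∧
      HasZeroMean (Torus.timeDerivWithin (Icc 0 3) u 1) := ⟨hA1.1.isSmooth_slice h13, hA1.2.2.1 1 h13, hA1.2.2.2.1 1 h13⟩
  have hinit : (fun t => Wa (t + 1)) 0 = (fun t => W (t + 1)) 0 - a • Torus.timeDerivWithin (Ici 0) (fun t => u (t + 1)) 0 := by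
    show Wa (0 + 1) = W (0 + 1) - a • Torus.timeDerivWithin (Ici 0) (fun t => u (t + 1)) 0
    rw [zero_add]
    -- `∂ₜu₁ 0 = ∂ₜu 1`, computed within `[0, 3]`
    have hder : Torus.timeDerivWithin (Ici 0) (fun t => u (t + 1)) 0 = Torus.timeDerivWithin (Icc 0 3) u 1 := by
      funext x
      have e1 := Literature.Analysis.FluidPDE.Torus.timeDerivWithin_comp_add_const (Ici (1 : ℝ)) u 1 0 x
      have hpre : (fun s : ℝ => s + 1) ⁻¹' Ici (1 : ℝ) = Ici 0 := by
        ext s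
        simp only [mem_preimage, mem_Ici]
        constructor <;> intro hs <;> linarith
      rw [hpre, zero_add] at e1
      rw [e1, hsol.smooth_velocity.timeDerivWithin_eq_of_subset (Ici_subset_Ici.2 zero_le_one) (uniqueDiffOn_Ici 1)
        (mem_Ici.2 le_rfl) x, ← hsol.smooth_velocity.timeDerivWithin_eq_of_subset hsubI (uniqueDiffOn_Icc h3) h13 x]
    rw [hder]
    -- the frames at `n = 1`
    have hT1a := hTWa 1 le_rfl
    have hT1 := hTW 1 le_rfl
    rw [Nat.cast_one] at hT1a hT1
    have hT1X : derivCocycle (F.modelMap ν xF U') y 1 (flowDir (F.modelMap ν xF U') y) =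
        F.S (stateOf (Torus.timeDerivWithin (Icc 0 3) u 1) - stateOf (laplacian (Torus.timeDerivWithin (Icc 0 3) u 1))) := by
      have e : F.modelMap ν xF U' ((0 : ℕ) : ℝ) y = y := by rw [Nat.cast_zero, hg0]
      rw [derivCocycle_succ, ContinuousLinearMap.comp_apply, derivCocycle_zero, e, one_apply_eq_self]
      exact fderiv_modelMap_one_flowDir F hν xF hU hU' hUU' htube hcont hy0 hsol hum horb
    have hS : stateOf (Wa 1) = stateOf (W 1) - a • stateOf (Torus.timeDerivWithin (Icc 0 3) u 1) := by
      calc stateOf (Wa 1) = F.S (F.S (stateOf (Wa 1) - stateOf (laplacian (Wa 1)))) :=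
            (hfr (hWah 1 le_rfl).1 (hWah 1 le_rfl).2.1 (hWah 1 le_rfl).2.2).symm
        _ = F.S (derivCocycle (F.modelMap ν xF U') y 1 (h - a • flowDir (F.modelMap ν xF U') y)) := by rw [hT1a]
        _ = F.S (derivCocycle (F.modelMap ν xF U') y 1 h) -
              a • F.S (derivCocycle (F.modelMap ν xF U') y 1 (flowDir (F.modelMap ν xF U') y)) := by
            rw [(derivCocycle (F.modelMap ν xF U') y 1).map_sub, (derivCocycle (F.modelMap ν xF U') y 1).map_smul,
              F.S.map_sub, F.S.map_smul]
        _ = stateOf (W 1) - a • stateOf (Torus.timeDerivWithin (Icc 0 3) u 1) := by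
            rw [hT1, hT1X, hfr (hWh 1 le_rfl).1 (hWh 1 le_rfl).2.1 (hWh 1 le_rfl).2.2, hfr hdu.1 hdu.2.1 hdu.2.2]
    -- the right-hand side is the state of the honest field `W 1 - a • ∂ₜu 1`
    have hvs : IsSmooth (W 1 - a • Torus.timeDerivWithin (Icc 0 3) u 1) := (hWh 1 le_rfl).1.sub (hdu.1.smul a)
    have hvd : IsDivFree (W 1 - a • Torus.timeDerivWithin (Icc 0 3) u 1) := fun x => by
      rw [divergence_sub ((hWh 1 le_rfl).1.isContDiff (by simp)) ((hdu.1.smul a).isContDiff (by simp)),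
        divergence_const_smul (hdu.1.isContDiff (by simp)), (hWh 1 le_rfl).2.1 x, hdu.2.1 x, mul_zero, sub_zero]
    have hrepv : rep (stateOf (W 1) - a • stateOf (Torus.timeDerivWithin (Icc 0 3) u 1)) =ᵐ[volume]
        (W 1 - a • Torus.timeDerivWithin (Icc 0 3) u 1) := by
      have h1 : rep (stateOf (W 1) - a • stateOf (Torus.timeDerivWithin (Icc 0 3) u 1)) =ᵐ[volume]
          fun x => rep (stateOf (W 1)) x - rep (a • stateOf (Torus.timeDerivWithin (Icc 0 3) u 1)) x := by
        show (((stateOf (W 1) - a • stateOf (Torus.timeDerivWithin (Icc 0 3) u 1) : Hsp) :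
            Lp (EuclideanSpace ℝ (Fin 3)) 2 (volume : Measure (UnitAddTorus (Fin 3)))) :
            (UnitAddTorus (Fin 3)) → (EuclideanSpace ℝ (Fin 3))) =ᵐ[volume] _
        rw [Submodule.coe_sub]
        exact Lp.coeFn_sub _ _
      have h2 : rep (a • stateOf (Torus.timeDerivWithin (Icc 0 3) u 1)) =ᵐ[volume]
          fun x => a • rep (stateOf (Torus.timeDerivWithin (Icc 0 3) u 1)) x := by
        show (((a • stateOf (Torus.timeDerivWithin (Icc 0 3) u 1) : Hsp) :
            Lp (EuclideanSpace ℝ (Fin 3)) 2 (volume : Measure (UnitAddTorus (Fin 3)))) :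
            (UnitAddTorus (Fin 3)) → (EuclideanSpace ℝ (Fin 3))) =ᵐ[volume] _
        rw [Submodule.coe_smul]
        exact Lp.coeFn_smul _ _
      filter_upwards [h1, h2, rep_stateOf (hWh 1 le_rfl).1 (hWh 1 le_rfl).2.1 (hWh 1 le_rfl).2.2,
        rep_stateOf hdu.1 hdu.2.1 hdu.2.2] with x e1 e2 e3 e4
      rw [e1, e2, e3, e4, Pi.sub_apply, Pi.smul_apply]
    have hxv := eq_stateOf_of_rep_ae_eq _ hvs hvd hrepv
    rw [hxv] at hS
    exact eq_of_stateOf_eq (hWah 1 le_rfl).1 (hWah 1 le_rfl).2.1 (hWah 1 le_rfl).2.2 hvs hvd (hasZeroMean_of_rep_ae_eq _ hrepv) hS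
  -- (8) exponential decay of `Wa (· + 1)` in `L²`, then in `H¹` one step later (A2)
  have hlinWa₁ := hshift hlinWa
  have hExp : ExpDecay fun t => Wa (t + 1) := ha _ _ hlinWa₁ hinit
  have hV := (stub_linearisedRateTransferTools hν hsol₁ (fun t ht x => hBM (t + 1) (hsubpre ht) x) (C := fun _ => B)
    (fun i t ht x => hBC i (t + 1) (hsubpre ht) x) hlinWa₁).1 hExp
  -- (9) back to the cocycle
  have hsq : SeqExpDecay fun n => ‖derivCocycle (F.modelMap ν xF U') y n (h - a • flowDir (F.modelMap ν xF U') y)‖ ^ 2 := by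
    refine SeqExpDecay.of_succ_le hV (by norm_num : (0 : ℝ) ≤ 2) fun n => ?_
    obtain ⟨hs, hd, hmn⟩ := hWah ((n : ℝ) + 1) (by have : (0 : ℝ) ≤ n := n.cast_nonneg; linarith)
    have hT := hTWa (n + 1) (Nat.succ_pos n)
    rw [Nat.cast_succ] at hT
    rw [hT]
    exact (hfrnorm hs hd hmn).2
  exact (seqExpDecay_sq_iff fun n => norm_nonneg _).1 hsq

end Summit.AnomalousDissipation.AnomalousDissipation.Theorems.DenseLoudDesignerForces.Ergodic

end
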